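/-
Origin: expansion seat `planner-pub-hodgecm-prl1-g4-0`, handover #8 2026-08-18T08:40:23Z ; doc-only v2 by prl1-g5 #3 2026-08-18T09:18:29Z (`HOME/pub-hodgecm-prl1-g5/lean/Prl1g5r27/AdelicTorusCompactInput.lean`, md5 d217d556, 543 lines);
landed by the gen-7 packager in gate run 27 as `HodgeCM/Automorphic/AdelicTorusCompactInput.lean` (verbatim).
-/
/-
HodgeCM / automorphic layer — publication cell pub-hodgecm, EXPANSION PROVER a-1 (pub-hodgecm-prl1-g4, HANDOVER #8).
Imports (all TREE after RUN 26): my HANDOVER #7 `HodgeCM.Automorphic.AdelicTorusThetaData` (c86af22f700a) and pv15-g2's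
run-26 files `HodgeCM.Automorphic.KernelCompactTorusModel` (1c6c0cb6c2fe) and `HodgeCM.Automorphic.LatticePartitionOfUnity`
(50631633618f) — consumed BY NAME, nothing restated. (Developed before RUN 26 against DO-NOT-LAND import-rewritten copies
`R26pre.*`; the import lines below are the only thing that changed at re-pointing.)
Complete proofs, no new axioms, no new hypotheses.
v2 (DOC-ONLY, 2026-08-18, lineage successor pub-hodgecm-prl1-g5 / planner-pub-hodgecm-prl1-g5-0): the three field docstrings
`CompactRest.allowed / emb / emb_surj` reworded per referee adv1g18-X43 ("allowed" had been used for membership in the index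
set `X`, i.e. type-`w` exhaustion); NO statement, class, proof or import change versus v1 (md5 7b9b757fb21e).
-/
import Summits.HodgeConjecture.HodgeCM.Automorphic.AdelicTorusThetaData_2
import Summits.HodgeConjecture.HodgeCM.Automorphic.KernelCompactTorusModel
import Summits.HodgeConjecture.HodgeCM.Automorphic.LatticePartitionOfUnity

/-!
# The compact inputs of the GENUINE tori: `β`, `[T]`, `T(L₀ ⊗ ℝ)`, `w`, `E_w` are constructed

pv15-g2's `KernelTorusCarrier.CompactInput` (PerL v5 Prop. 3.6 Step 2 over the compact quotient `[T] = T(𝔸)/T(L₀)`,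
with `unfold` [AX12(ii)], `fourier`, `PT_cov`, `res_spec`, `res_transl` all THEOREMS) is INSTANTIATED for the tori of
HANDOVER #7 — `T(𝔸) := SeesawTorus L⁺ L` (pv11-g5), `ν := SeesawTorus.haar`, `jT := jT₁₂Model / jT₃₄Model` — and
every field that the tree can construct IS constructed:

* §11 `LatticePU.beta Λ` — A CHOSEN `T(L₀)`-partition of unity `β ∈ C_c(T, ℝ)`, `β ≥ 0`, `∑_{a ∈ Λ} β(t a) = 1`
  (pv15-g2 `LatticePU.exists_partitionOfUnity`; PerL l. 405); so the carrier's `β` is no longer DATA;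
* §12 `Universe.CompactRest K L jT` — what REMAINS per context and torus side: the DATA `X, allowed, χᵥ` (pv15-g2's
  character bookkeeping) and the archimedean type `(m₁, m₂)` of the weight, the identifications `emb, emb_spec, emb_surj`
  (← pv11-g5 CLAIM #4 `SeesawChars`) and the finite-adelic block `Gf, ιf, comm, dense` (hypothesis fields HERE; THEOREMS of pv06-g4's
  `AdelicUnitaryFactorisation` — kernel real approximation via pv06-g2 — plugged in by HANDOVER #9)
  (← pv06-g4 CLAIM #3 `AdelicUnitaryFactorisation`); from it `CompactRest.rest` (the `TorusCarrierRest` of #7 with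
  `Tι := SeesawArchTorus L`, `torus := jT ∘ toAdeles`, `w := SeesawArchTorus.weight L m₁ m₂`, `β := LatticePU.beta`) and
  **`CompactRest.compactInput`** : pv15-g2's `CompactInput` with `Λ := SeesawTorus.rat` (+ its five instances),
  `exists_fd`, `jT_Λ`, `β_sum`, `Tc := SeesawArchTorus L` (+ six instances), `μ := probHaar`, `ιc := toAdeles`,
  `w := weight`, `w_cont`, `w_norm` CONSTRUCTED / PROVED and `Ew_eq` by `rfl`;
* §13 `Universe.AdelicTorusCore hP` (= `AdelicTorusThetaData` minus `tr12/tr34`), `withRest`, the two reduced torus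
  datums `A12of/A34of` as DEFINITIONS, and the END STATE
  `Assembly.realisationExists_ofAdelicTorusCompactRest (M) (hP) (C) (R12 R34) (A) (hHR) : RealisationExistsPerL ∧ Face`
  (+ `perL_…`, `COR_CM_endState_…`) — versus #7 the hypotheses `A12/A34 : QuotientTorusDatum …` are GONE.
-/

set_option autoImplicit false

noncomputable section

open NumberField TopologicalSpace MeasureTheory Set Filter Function
open scoped Topology CompactlySupported

attribute [-instance] Quotient.instMeasurableSpace

namespace HodgeCM

/-! ## §11 A chosen partition of unity -/

namespace LatticePU

variable {T : Type*} [Group T] [TopologicalSpace T] [IsTopologicalGroup T] [LocallyCompactSpace T] [T2Space T]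
  (Λ : Subgroup T) [DiscreteTopology Λ] [CompactSpace (T ⧸ Λ)]

/-- **A chosen `Λ`-partition of unity** `β ∈ C_c(T, ℝ)` (PerL v5 l. 405), from `exists_partitionOfUnity`. -/
def beta : C_c(T, ℝ) := (exists_partitionOfUnity Λ).choose

/-- (Ported verbatim from the HodgeCMPerL package; no docstring in the source.) -/
theorem beta_nonneg (t : T) : 0 ≤ beta Λ t := (exists_partitionOfUnity Λ).choose_spec.1 t

/-- (Ported verbatim from the HodgeCMPerL package; no docstring in the source.) -/
theorem beta_sum (t : T) : ∑' a : Λ.op, beta Λ (a • t) = 1 := (exists_partitionOfUnity Λ).choose_spec.2 t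

/-- (Ported verbatim from the HodgeCMPerL package; no docstring in the source.) -/
theorem beta_sum_complex (t : T) : ∑' a : Λ.op, ((beta Λ (a • t) : ℝ) : ℂ) = 1 := by
  rw [← Complex.ofReal_tsum, beta_sum Λ t, Complex.ofReal_one]

end LatticePU

/-! ## §12 The residual compact input of a genuine torus side -/

namespace Universe

open HodgeCM.PerL34 HodgeCM.PerL34.N23a HodgeCM.PerL34.Annihilation HodgeCM.PerL34.CompactTorusModel
open HodgeCM.Adelic

section CompactRest

variable {G : Type} [Group G] [TopologicalSpace G] {Γ : Subgroup G} [MeasurableSpace (G ⧸ Γ)]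
  {μQ : Measure (G ⧸ Γ)} {XU : Type} [TopologicalSpace XU]
  {HG : Type} [NormedAddCommGroup HG] [InnerProductSpace ℂ HG] [CompleteSpace HG]
  {SK SigIdxG : Type} [TopologicalSpace SK]

/-- **What remains of Prop. 3.6 Step 2 for a GENUINE torus side** `T(𝔸) = SeesawTorus L⁺ L ↪ U(W)(𝔸)` (via `jT`):
DATA — the character bookkeeping `X, allowed, χᵥ` of pv15-g2's carrier and the archimedean type `(m₁, m₂)` of the
weight `w = χ_∞` — and HYPOTHESES — the identifications `emb, emb_spec, emb_surj` (PerL ll. 425–427; pv11-g5's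
`SeesawChars`) and the finite-adelic block `Gf, ιf, comm` with the density `dense` (kernel real approximation: pv06-g2
`AnnihilationDense.dense_cosets_of_dictionary`, pv06-g4's `AdelicUnitaryFactorisation.dense_cosets`; plugged in by #9). -/
structure CompactRest (K : KernelCoreCarrier G Γ μQ XU HG SK SigIdxG) (L : Type) [Field L] [NumberField L]
    [IsCMField L] (jT : SeesawTorus (maximalRealSubfield L) L →ₜ* G) where
  /-- the characters `χ` of `[T]` with `χ_∞ = w` — bare index type -/
  X : Type
  /-- `χ` arises from an allowed pair: PerL Def 3.2 ALLOWEDNESS, a predicate ON the index set `X` (Prop 3.6's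
  hypothesis "every `χ ∈ X` is allowed" is the separate open input `ThetaModel.Open_chars`, never discharged here) -/
  allowed : X → Prop
  /-- the character `χ` indexed by `x : X`, as a continuous function on `T(𝔸)` -/
  χv : X → C(SeesawTorus (maximalRealSubfield L) L, ℂ)
  /-- archimedean type of the weight on the first factor `U(1)(L₀ ⊗ ℝ)` -/
  m₁ : InfinitePlace L → ℤ
  /-- archimedean type of the weight on the second factor -/
  m₂ : InfinitePlace L → ℤ
  /-- the characters indexed by `X` among the characters of `[T] = T(𝔸) ⧸ T(L₀)` … -/
  emb : X → PontryaginDual (SeesawTorus (maximalRealSubfield L) L ⧸ SeesawTorus.rat (maximalRealSubfield L) L)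
  /-- … ARE the carrier's characters `χᵥ` -/
  emb_spec : ∀ (χ : X) (t : SeesawTorus (maximalRealSubfield L) L), dualChar (emb χ) (QuotientGroup.mk t) = χv χ t
  /-- ll. 398–400 / 425–427: every character of `[T]` with `ξ_∞ = w(m₁, m₂)` lies in the index set `X` (`X` EXHAUSTS
  the characters of archimedean type `w` — NOT Def 3.2 allowedness, which is the field `allowed`) -/
  emb_surj : ∀ ξ : PontryaginDual (SeesawTorus (maximalRealSubfield L) L ⧸ SeesawTorus.rat (maximalRealSubfield L) L),
    (dualChar ξ).comp ((QuotientGroup.mk' (SeesawTorus.rat (maximalRealSubfield L) L)).comp (SeesawArchTorus.toAdeles L))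
      = SeesawArchTorus.weight L m₁ m₂ → ∃ χ : X, emb χ = ξ
  /-- the finite-adelic factor `U(W)(𝔸_f)`, commuting with the archimedean torus -/
  Gf : Type
  [instGf : Group Gf]
  ιf : Gf →* G
  comm : ∀ (hf : Gf) (t : SeesawArchTorus L),
    ιf hf * jT (SeesawArchTorus.toAdeles L t) = jT (SeesawArchTorus.toAdeles L t) * ιf hf
  /-- `U(W)(L₀) · T(𝔸) · U(W)(𝔸_f)` is dense in `U(W)(𝔸)` (a hypothesis field here; a THEOREM for the genuine group, #9) -/
  dense : Dense {g : G | ∃ γ ∈ Γ, ∃ (t : SeesawTorus (maximalRealSubfield L) L) (hf : Gf), g = γ * jT t * ιf hf}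

attribute [instance] CompactRest.instGf

namespace CompactRest

variable {K : KernelCoreCarrier G Γ μQ XU HG SK SigIdxG} {L : Type} [Field L] [NumberField L] [IsCMField L]
  {jT : SeesawTorus (maximalRealSubfield L) L →ₜ* G} (R : CompactRest K L jT)

/-- **The torus-side carrier data, COMPLETED**: `Tι := T(L₀ ⊗ ℝ) = SeesawArchTorus L`, `torus := jT ∘ toAdeles`,
`w := weight m₁ m₂`, `β :=` the chosen `T(L₀)`-partition of unity. -/
@[reducible] def rest : TorusCarrierRest K (SeesawTorus (maximalRealSubfield L) L) where
  X := R.X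
  allowed := R.allowed
  Tι := SeesawArchTorus L
  torus := ⇑(jT.toMonoidHom.comp (SeesawArchTorus.toAdeles L))
  w := ⇑(SeesawArchTorus.weight L R.m₁ R.m₂)
  β := LatticePU.beta (SeesawTorus.rat (maximalRealSubfield L) L)
  χv := R.χv

/-- The kernel-model torus carrier of the side: `ν := SeesawTorus.haar`, `jT := jT`. -/
abbrev kt : KernelTorusCarrier K (SeesawTorus (maximalRealSubfield L) L) :=
  R.rest.toKernelTorusCarrier (SeesawTorus.haar (maximalRealSubfield L) L) jT

/-- (Ported verbatim from the HodgeCMPerL package; no docstring in the source.) -/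
@[simp] theorem kt_ν : R.kt.ν = SeesawTorus.haar (maximalRealSubfield L) L := rfl
/-- (Ported verbatim from the HodgeCMPerL package; no docstring in the source.) -/
@[simp] theorem kt_jT : R.kt.jT = jT := rfl
/-- (Ported verbatim from the HodgeCMPerL package; no docstring in the source.) -/
@[simp] theorem kt_β : R.kt.β = LatticePU.beta (SeesawTorus.rat (maximalRealSubfield L) L) := rfl
/-- (Ported verbatim from the HodgeCMPerL package; no docstring in the source.) -/
@[simp] theorem kt_Tι : R.kt.Tι = SeesawArchTorus L := rfl

/-- (Ported verbatim from the HodgeCMPerL package; no docstring in the source.) -/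
theorem isFiniteMeasureOnCompacts_kt_ν : IsFiniteMeasureOnCompacts R.kt.ν :=
  SeesawTorus.isFiniteMeasureOnCompacts_haar _ _
/-- (Ported verbatim from the HodgeCMPerL package; no docstring in the source.) -/
theorem isMulRightInvariant_kt_ν : R.kt.ν.IsMulRightInvariant := SeesawTorus.isMulRightInvariant_haar _ _
/-- (Ported verbatim from the HodgeCMPerL package; no docstring in the source.) -/
theorem isOpenPosMeasure_kt_ν : R.kt.ν.IsOpenPosMeasure := SeesawTorus.isOpenPosMeasure_haar _ _

end CompactRest

end CompactRest

section CompactInputOf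

variable {G : Type} [Group G] [TopologicalSpace G] [IsTopologicalGroup G] [T2Space G] [LocallyCompactSpace G]
  [MeasurableSpace G] [BorelSpace G]
variable {Γ : Subgroup G} [DiscreteTopology Γ] [IsClosed (Γ : Set G)] [MeasurableSpace (G ⧸ Γ)] [BorelSpace (G ⧸ Γ)]
  [CompactSpace (G ⧸ Γ)]
variable {μQ : Measure (G ⧸ Γ)} [SMulInvariantMeasure G (G ⧸ Γ) μQ] [IsFiniteMeasure μQ]
variable {XU : Type} [TopologicalSpace XU] [CompactSpace XU]
variable {HG : Type} [NormedAddCommGroup HG] [InnerProductSpace ℂ HG] [CompleteSpace HG]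
variable {SK SigIdxG : Type} [TopologicalSpace SK]
variable {K : KernelCoreCarrier G Γ μQ XU HG SK SigIdxG} {L : Type} [Field L] [NumberField L] [IsCMField L]
  {jT : SeesawTorus (maximalRealSubfield L) L →ₜ* G} (R : CompactRest K L jT)

/-- **pv15-g2's compact input of the side, every constructible field CONSTRUCTED**: `Λ := T(L₀) = SeesawTorus.rat`
(countable, closed, compact Borel quotient — pv11-g5), `exists_fd` (pv11-g5 / pv09-g4), `jT_Λ` (hypothesis `hΛ`; for
`jT₁₂Model/jT₃₄Model` it is #7's `rat_le_comap_jT…Model`), `β_sum` (§11), `Tc := T(L₀ ⊗ ℝ) = SeesawArchTorus L` with its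
probability Haar measure and `ιc := toAdeles`, `w := weight m₁ m₂` continuous unitary, `Ew_eq := rfl`; the residual
fields from `R`. -/
def CompactRest.compactInput
    (hΛ : SeesawTorus.rat (maximalRealSubfield L) L ≤ Γ.comap jT.toMonoidHom) : R.kt.CompactInput where
  Λ := SeesawTorus.rat (maximalRealSubfield L) L
  exists_fd := by
    obtain ⟨𝓕, -, h𝓕, -, hlt⟩ :=
      SeesawTorus.exists_isFundamentalDomain_rat_op (maximalRealSubfield L) L (SeesawTorus.haar (maximalRealSubfield L) L)
    exact ⟨𝓕, h𝓕, hlt⟩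
  jT_Λ := hΛ
  β_sum := LatticePU.beta_sum_complex (SeesawTorus.rat (maximalRealSubfield L) L)
  Tc := SeesawArchTorus L
  μ := SeesawArchTorus.probHaar L
  ιc := SeesawArchTorus.toAdeles L
  ιc_cont := SeesawArchTorus.continuous_toAdeles L
  w := SeesawArchTorus.weight L R.m₁ R.m₂
  w_cont := SeesawArchTorus.continuous_weight L R.m₁ R.m₂
  w_norm := SeesawArchTorus.norm_weight L R.m₁ R.m₂
  Ew_eq := rfl
  emb := R.emb
  emb_spec := R.emb_spec
  emb_surj := R.emb_surj
  Gf := R.Gf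
  ιf := R.ιf
  comm := R.comm
  dense := R.dense

/-- (Ported verbatim from the HodgeCMPerL package; no docstring in the source.) -/
@[simp] theorem CompactRest.compactInput_Λ (hΛ : SeesawTorus.rat (maximalRealSubfield L) L ≤ Γ.comap jT.toMonoidHom) :
    (R.compactInput hΛ).Λ = SeesawTorus.rat (maximalRealSubfield L) L := rfl

/-- (Ported verbatim from the HodgeCMPerL package; no docstring in the source.) -/
@[simp] theorem CompactRest.compactInput_Tc (hΛ : SeesawTorus.rat (maximalRealSubfield L) L ≤ Γ.comap jT.toMonoidHom) :
    (R.compactInput hΛ).Tc = SeesawArchTorus L := rfl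

end CompactInputOf

/-! ## §12b Transport of the residual block from `U(W)(𝔸)` to the regime model

pv06-g4's `AdelicUnitaryFactorisation` delivers `Gf, ιf, comm, dense` on the GENUINE group `adelicUnitaryGroup L H` with
`Γ := adelicUnitaryRat L H`; the kernel model of a context lives on the REGIME MODEL `↥(regimeSubgroup L H)` (#5b v2) with
`jT := regimeLift L H φ` (#7).  The transport is done HERE once and for all: `regimeLiftHom`, `comm_regimeLift`,
`dense_regimeLift`, and the constructor `AdelicRest.toCompactRest`. -/

end Universe

namespace Adelic

section RegimeLiftHom

variable (L : CMField) {n : Type} [Fintype n] [DecidableEq n] (H : Matrix n n L) {Gf : Type} [Group Gf]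

open Classical in
/-- **A group homomorphism into `U(H)(𝔸)`, lifted to the regime model**: `regimeEquiv ∘ ψ` in the regime, trivial
outside it. -/
def regimeLiftHom (ψ : Gf →* adelicUnitaryGroup L H) : Gf →* ↥(regimeSubgroup L H) :=
  if h : IsAnisotropic L H then (regimeEquiv L H h).toMulEquiv.toMonoidHom.comp ψ else 1

variable {L H}

/-- (Ported verbatim from the HodgeCMPerL package; no docstring in the source.) -/
theorem regimeLiftHom_of_isAnisotropic (h : IsAnisotropic L H) (ψ : Gf →* adelicUnitaryGroup L H) :
    regimeLiftHom L H ψ = (regimeEquiv L H h).toMulEquiv.toMonoidHom.comp ψ := by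
  classical
  exact dif_pos h

/-- (Ported verbatim from the HodgeCMPerL package; no docstring in the source.) -/
@[simp] theorem coe_regimeLiftHom_apply (h : IsAnisotropic L H) (ψ : Gf →* adelicUnitaryGroup L H) (k : Gf) :
    ((regimeLiftHom L H ψ k : ↥(regimeSubgroup L H)) : adelicUnitaryGroup L H) = ψ k := by
  rw [regimeLiftHom_of_isAnisotropic h]
  rfl

/-- (Ported verbatim from the HodgeCMPerL package; no docstring in the source.) -/
theorem regimeLiftHom_of_not_isAnisotropic (h : ¬ IsAnisotropic L H) (ψ : Gf →* adelicUnitaryGroup L H) :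
    regimeLiftHom L H ψ = 1 := by
  classical
  exact dif_neg h

/-- Outside the regime the model group is trivial. -/
theorem eq_one_of_not_isAnisotropic (h : ¬ IsAnisotropic L H) (g : ↥(regimeSubgroup L H)) : g = 1 :=
  Subtype.ext (((mem_regimeSubgroup_iff (g : adelicUnitaryGroup L H)).1 g.2).resolve_left h)

/-- **Transport of `comm`**: if `ψ k` commutes with `φ (ιc t)` in `U(H)(𝔸)`, the lifts commute in the regime model. -/
theorem comm_regimeLift {T : Type} [Group T] [TopologicalSpace T] (φ : T →ₜ* adelicUnitaryGroup L H)
    (ψ : Gf →* adelicUnitaryGroup L H) {Tc : Type} (ιc : Tc → T)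
    (hc : ∀ (k : Gf) (t : Tc), ψ k * φ (ιc t) = φ (ιc t) * ψ k) (k : Gf) (t : Tc) :
    regimeLiftHom L H ψ k * regimeLift L H φ (ιc t) = regimeLift L H φ (ιc t) * regimeLiftHom L H ψ k := by
  by_cases h : IsAnisotropic L H
  · apply Subtype.ext
    simp only [Subgroup.coe_mul, coe_regimeLiftHom_apply h, coe_regimeLift_apply h]
    exact hc k t
  · rw [eq_one_of_not_isAnisotropic h (regimeLiftHom L H ψ k), one_mul, mul_one]

/-- **Transport of `dense`**: density of `U(H)(L⁺) · φ(T) · ψ(Gf)` in `U(H)(𝔸)` gives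
density of `Γ · regimeLift φ (T) · regimeLiftHom ψ (Gf)` in the regime model (a homeomorphic image in the regime; a
one-point space outside it). -/
theorem dense_regimeLift {T : Type} [Group T] [TopologicalSpace T] (φ : T →ₜ* adelicUnitaryGroup L H)
    (ψ : Gf →* adelicUnitaryGroup L H)
    (hd : Dense {g : adelicUnitaryGroup L H |
      ∃ γ ∈ adelicUnitaryRat L H, ∃ (t : T) (k : Gf), g = γ * φ t * ψ k}) :
    Dense {g : ↥(regimeSubgroup L H) |
      ∃ γ ∈ regimeRat L H, ∃ (t : T) (k : Gf), g = γ * regimeLift L H φ t * regimeLiftHom L H ψ k} := by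
  by_cases h : IsAnisotropic L H
  · refine ((regimeEquiv L H h).surjective.denseRange.dense_image (regimeEquiv L H h).continuous hd).mono ?_
    rintro _ ⟨g, ⟨γ, hγ, t, k, rfl⟩, rfl⟩
    refine ⟨regimeEquiv L H h γ, (regimeEquiv_mem_regimeRat_iff L H h γ).2 hγ, t, k, ?_⟩
    rw [map_mul, map_mul]
    congr 1
    · congr 1
      exact Subtype.ext (by rw [coe_regimeEquiv, coe_regimeLift_apply h])
    · exact Subtype.ext (by rw [coe_regimeEquiv, coe_regimeLiftHom_apply h])
  · refine dense_univ.mono fun g _ => ⟨1, one_mem _, 1, 1, ?_⟩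
    rw [eq_one_of_not_isAnisotropic h g, map_one, map_one, mul_one, mul_one]

end RegimeLiftHom

end Adelic

namespace Universe

open HodgeCM.PerL34 HodgeCM.PerL34.Annihilation HodgeCM.PerL34.CompactTorusModel HodgeCM.Adelic

section AdelicRest

variable (L : CMField) {n : Type} [Fintype n] [DecidableEq n] (H : Matrix n n L)
  (φ : SeesawTorus (maximalRealSubfield L) L →ₜ* adelicUnitaryGroup L H)

/-- **The residual block stated on the GENUINE adelic unitary group** `U(H)(𝔸_L)` (what pv11-g5's `SeesawChars` and
pv06-g4's `AdelicUnitaryFactorisation` deliver): characters, `emb` identifications, `Gf`, `ψ : Gf →* U(H)(𝔸)`, `comm`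
with the archimedean torus through `φ`, and the density of `U(H)(L⁺) · φ(T(𝔸)) · ψ(Gf)` (pv06-g4 `dense_cosets`, kernel). -/
structure AdelicRest where
  X : Type
  allowed : X → Prop
  χv : X → C(SeesawTorus (maximalRealSubfield L) L, ℂ)
  m₁ : InfinitePlace L → ℤ
  m₂ : InfinitePlace L → ℤ
  emb : X → PontryaginDual (SeesawTorus (maximalRealSubfield L) L ⧸ SeesawTorus.rat (maximalRealSubfield L) L)
  emb_spec : ∀ (χ : X) (t : SeesawTorus (maximalRealSubfield L) L), dualChar (emb χ) (QuotientGroup.mk t) = χv χ t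
  emb_surj : ∀ ξ : PontryaginDual (SeesawTorus (maximalRealSubfield L) L ⧸ SeesawTorus.rat (maximalRealSubfield L) L),
    (dualChar ξ).comp ((QuotientGroup.mk' (SeesawTorus.rat (maximalRealSubfield L) L)).comp (SeesawArchTorus.toAdeles L))
      = SeesawArchTorus.weight L m₁ m₂ → ∃ χ : X, emb χ = ξ
  Gf : Type
  [instGf : Group Gf]
  ψ : Gf →* adelicUnitaryGroup L H
  comm : ∀ (k : Gf) (t : SeesawArchTorus L),
    ψ k * φ (SeesawArchTorus.toAdeles L t) = φ (SeesawArchTorus.toAdeles L t) * ψ k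
  dense : Dense {g : adelicUnitaryGroup L H |
    ∃ γ ∈ adelicUnitaryRat L H, ∃ (t : SeesawTorus (maximalRealSubfield L) L) (k : Gf), g = γ * φ t * ψ k}

attribute [instance] AdelicRest.instGf

variable {L H φ}
-- the measurable structure of the quotient is found by UNIFICATION from `K` (at the use site it is the tree's
-- `QuotientModel` instance, whose head does not match `↥(regimeSubgroup L H) ⧸ regimeRat L H` syntactically)
variable {instMS : MeasurableSpace (↥(regimeSubgroup L H) ⧸ regimeRat L H)}
  {μQ : Measure (↥(regimeSubgroup L H) ⧸ regimeRat L H)} {XU : Type} [TopologicalSpace XU]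
  {HG : Type} [NormedAddCommGroup HG] [InnerProductSpace ℂ HG] [CompleteSpace HG]
  {SK SigIdxG : Type} [TopologicalSpace SK]

/-- **The residual compact input of the regime model from the adelic-level residual block** (`ιf := regimeLiftHom ψ`,
`comm`, `dense` transported by §12b). -/
def AdelicRest.toCompactRest (A : AdelicRest L H φ)
    (K : KernelCoreCarrier (↥(regimeSubgroup L H)) (regimeRat L H) μQ XU HG SK SigIdxG) :
    CompactRest K (L : Type) (regimeLift L H φ) where
  X := A.X
  allowed := A.allowed
  χv := A.χv
  m₁ := A.m₁
  m₂ := A.m₂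
  emb := A.emb
  emb_spec := A.emb_spec
  emb_surj := A.emb_surj
  Gf := A.Gf
  ιf := regimeLiftHom L H A.ψ
  comm := comm_regimeLift φ A.ψ (SeesawArchTorus.toAdeles L) A.comm
  dense := dense_regimeLift φ A.ψ A.dense

end AdelicRest

/-! ## §13 Universe level: END STATE without `A12 / A34` -/

open HodgeCM.PerL34 HodgeCM.PerL34.Annihilation HodgeCM.Adelic
open HodgeCM.Prior.Perl34File HodgeCM.Prior.Perl34File.Perl34

variable (U : Universe)

/-- **The data of #7's `AdelicTorusThetaData` that are NOT per-torus-side**: `emb`, `cover`, the sign recipe, the Weil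
theta model of each context over the adelic unitary groups, the theta one-forms. -/
structure AdelicTorusCore (hP : PrintFact_unitaryCompact) where
  /-- degree-two classes of `P_Γ` as `L²` functions on `[G_U]` -/
  emb : ∀ {L : CMField} {ι₁ : L →+* ℂ} {V : HermSpace3 L ι₁} (Γ : Level V),
    U.CohC (U.pms L ι₁ V Γ) 2 →ₗ[ℂ] (V.latticeModel hP).toQuotientModel.H
  /-- the covering `P_{Γ'} → P_Γ` for `Γ' ≤ Γ` -/
  cover : ∀ {L : CMField} {ι₁ : L →+* ℂ} {V : HermSpace3 L ι₁} (Γ Γ' : Level V),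
    Γ'.Γ ≤ Γ.Γ → U.Mor (U.pms L ι₁ V Γ') (U.pms L ι₁ V Γ)
  /-- sign recipe, first half -/
  kappa : ∀ (K L : CMField), (K →+* L) → (L →+* ℂ) → (L →+* ℂ) → (K →+* ℂ)
  /-- sign recipe, second half -/
  frameSign : ∀ (L : CMField), (L →+* ℂ) → (L →+* ℂ) → Bool
  /-- the Weil theta model of the context, over the adelic unitary groups -/
  wm : ∀ {L : CMField} {ι₁ : L →+* ℂ} (V : HermSpace3 L ι₁) (c : SeesawCtx L),
    WeilThetaModel (V.latticeModel hP).toQuotientModel.G (V.latticeModel hP).toQuotientModel.Γ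
      (c.D.latticeModelW hP).toQuotientModel.G (c.D.latticeModelW hP).toQuotientModel.Γ
  /-- the theta one-forms of type `Ψ_i` at level `Γ` -/
  Theta : ∀ {L : CMField} {ι₁ : L →+* ℂ} (V : HermSpace3 L ι₁), SeesawCtx L → Fin 4 → ∀ Γ : Level V,
    Set (U.CohC (U.pms L ι₁ V Γ) 1)


-- port_pkg: scope closed for this part
end Universe
end HodgeCM
end
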